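import Literature.Geometry.Lorentzian.TameChartCompactness
import Literature.Geometry.Lorentzian.SpacetimeLocalConvergenceOfChartsFar
import HarnessLib

/-!
# Local Cheeger–Gromov compactness with far charts

The producer of `TameChartCompactness.lean` delivers, besides `SubconvergesLocallyTo`, subconvergence
WITH FAR CHARTS (`Spacetime.SubconvergesLocallyWithFarChartsTo`, the convergence notion of the
ω-limit clauses of the tame final-state routes): for charts `Ψₙ : B.domain → 𝓢ₙ` on the domain of any
model background `B` (e.g. the eternal Schwarzschild far zone `farBackground M R`), the limit
`(B.domain, G, ∂₀)` is reached with far charts `Ψ_{n} → id` — the deviations from `B.bilin`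
converge because their difference is the difference of the components
(`SpacetimeLocalConvergenceOfChartsFar.lean`).

## References
* P. Petersen, *Riemannian Geometry*, 2nd ed., GTM 171, Springer 2006, Ch. 10, §3.2. [Petersen2006]
* M. T. Anderson, Cheeger–Gromov theory and applications to general relativity, 2004, Def. 1.1. [Anderson2004]
-/

noncomputable section

open Set Metric Filter Topology Function TopologicalSpace
open scoped Manifold ContDiff Topology ENNReal

universe u

namespace Literature.Geometry.Lorentzian

namespace Spacetime

variable {𝓢ₙ : ℕ → Spacetime.{u} 4} {pₙ : ∀ n, (𝓢ₙ n).carrier}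

/-- **Local Cheeger–Gromov compactness for uniformly tame pointed spacetimes, with far charts**:
under the hypotheses of `exists_nearMinkowskiChart_subconvergesLocallyTo` for charts on the domain
of a model background `B`, the limit near-Minkowski chart spacetime is a pointed `Cᵏ_loc` limit WITH
FAR CHARTS `Ψₙ → id` relative to `B`, for every `k`. [cite: Petersen2006, Ch. 10 §3.2] -/
theorem exists_nearMinkowskiChart_subconvergesLocallyWithFarChartsTo (B : ModelBackground)
    (hO : IsConnected (B.domain : Set E4)) {y₀ : E4} (hy₀ : y₀ ∈ (B.domain : Set E4))
    (Ψ : ∀ n, B.domain → (𝓢ₙ n).carrier) (hΨ : ∀ n, ContMDiff 𝓘(ℝ, E4) (𝓡 4) ∞ (Ψ n))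
    (hinj : ∀ n, Injective (Ψ n)) (hcentre : ∀ n, Ψ n ⟨y₀, hy₀⟩ = pₙ n)
    (hfut : ∀ n, (𝓢ₙ n).timeOrientation.IsFutureDirected
      (mfderiv 𝓘(ℝ, E4) (𝓡 4) (Ψ n) ⟨y₀, hy₀⟩ (E4.basisVector 0)))
    {θ : ℝ} (hθ : θ < 1)
    (hpinch : ∀ n, ∀ y ∈ (B.domain : Set E4),
      ‖(𝓢ₙ n).deviationExtend (Minkowski.backgroundOn B.domain) (Ψ n) y‖ ≤ θ)
    (hbound : ∀ k : ℕ, ∃ Λ : ℝ≥0∞, Λ ≠ ⊤ ∧ ∀ n, supCkENorm (B.domain : Set E4) k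
      ((𝓢ₙ n).deviationExtend (Minkowski.backgroundOn B.domain) (Ψ n)) ≤ Λ) :
    ∃ (L : NearMinkowskiChart B.domain) (φ : ℕ → ℕ), StrictMono φ ∧
      (∀ y ∈ (B.domain : Set E4), ‖L.G y - Minkowski.bilin‖ ≤ θ) ∧
      (∀ (k : ℕ) (C : ℝ≥0∞), (∀ n, supCkENorm (B.domain : Set E4) k
          ((𝓢ₙ n).deviationExtend (Minkowski.backgroundOn B.domain) (Ψ n)) ≤ C) →
        supCkENorm (B.domain : Set E4) k (L.G - fun _ ↦ Minkowski.bilin) ≤ C) ∧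
      (∀ (k : ℕ), ∀ K ⊆ (B.domain : Set E4), IsCompact K →
        Tendsto (fun j ↦ supCkENorm K k
          ((𝓢ₙ (φ j)).deviationExtend (Minkowski.backgroundOn B.domain) (Ψ (φ j)) -
            (L.G - fun _ ↦ Minkowski.bilin))) atTop (𝓝 0)) ∧
      ∀ k : ℕ, SubconvergesLocallyWithFarChartsTo 𝓢ₙ pₙ (L.spacetime hO) ⟨y₀, hy₀⟩ k B Ψ
        (id : B.domain → (L.spacetime hO).carrier) := by
  obtain ⟨L, φ, hφ, h1, h2, h3, -⟩ := exists_nearMinkowskiChart_subconvergesLocallyTo hO hy₀ Ψ hΨ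
    hinj hcentre hfut hθ hpinch hbound
  refine ⟨L, φ, hφ, h1, h2, h3, fun k ↦ ?_⟩
  exact SubconvergesLocallyWithFarChartsTo.ofCharts B hO hy₀ Ψ hΨ hinj hcentre hfut
    (fun n y hy ↦ (hpinch n y hy).trans_lt hθ) L hφ fun K hKO hK ↦
      tendsto_supCkENorm_metricInCoords_sub_of_deviationExtend Ψ hΨ ⟨y₀, hy₀⟩ L.G hKO
        (h3 k K hKO hK)

end Spacetime

end Literature.Geometry.Lorentzian

end
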